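import Mathlib.Topology.Algebra.Module.ContinuousLinearMap.Basic
import HarnessLib

/-!
# Density inside a subspace from dense pieces transported by continuous linear maps

Topic `Analysis/OperatorTheory`; namespace `Literature.Analysis.OperatorTheory`.  A folklore transfer lemma.  Let
`S` be a subspace of a topological module `X`, and let continuous linear maps `T_i : E_i → X` carry subsets
`D_i ⊆ E_i` INTO `S`.  If every `s ∈ S` is a finite sum `Σ_i T_i φ_i` with each `φ_i` in the closure (in `E_i`) of the
span of `D_i`, then the span of `⋃_i T_i(D_i)` is dense IN `S` (subspace topology):
`dense_span_image_of_sum_decomposition`.  Auxiliary: `image_closure_span_subset`, `mem_topologicalClosure_span_of_sum`.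

Use (pub-hodgecm model cell, rows A12/A34, field `dense` of `HypSmoothSide`; junction J3 of the census design): `X` =
the adelic Schwartz space with the model's topology, `S = 𝒮^κ`, `E_f = 𝓢_∞` (Fréchet) for each finite test function
`Φ_f`, `T_f φ = φ ⊗ Φ_f` (continuous: theta majorants), `D_f` = the Folland–Fock vectors of the isotypic homogeneous
polynomials (tree `SegalBargmann/SchwartzIsotypicFockPolynomials`, `FockPlaceSubstitution`), the decomposition from
`RepresentationTheory/WeightSpaceTensorCoordinates.eq_sum_tmul_of_mem_weightSpace`.  Everything here is proved from
Mathlib; no cited fact. [folklore]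

Provenance: LEAN-IN-TREE rule (2026-08-18), pub-hodgecm model-construction sub-cell, seat mc-binder-2 gen 5; KERNEL only.
-/

set_option autoImplicit false

open Topology

namespace Literature.Analysis.OperatorTheory

variable {R : Type*} [Semiring R] {X : Type*} [AddCommMonoid X] [Module R X] [TopologicalSpace X]
  [ContinuousAdd X] [ContinuousConstSMul R X]
variable {ι : Type*} {E : ι → Type*} [∀ i, AddCommMonoid (E i)] [∀ i, Module R (E i)] [∀ i, TopologicalSpace (E i)]

omit [ContinuousAdd X] [ContinuousConstSMul R X] in
/-- A continuous linear map carries the closure of the span of `D` into the closure of the span of its image.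
[folklore] -/
theorem image_closure_span_subset (i : ι) (T : E i →L[R] X) (D : Set (E i)) :
    T '' closure (Submodule.span R D : Set (E i)) ⊆ closure (Submodule.span R (T '' D) : Set X) := by
  refine (image_closure_subset_closure_image T.continuous).trans (closure_mono ?_)
  rintro _ ⟨y, hy, rfl⟩
  have h := Submodule.mem_map_of_mem (f := (T : E i →ₗ[R] X)) hy
  rw [Submodule.map_span] at h
  exact h

/-- **A finite sum of transported limits lies in the closure of the joint span.** [folklore] -/
theorem mem_topologicalClosure_span_of_sum (T : ∀ i, E i →L[R] X) (D : ∀ i, Set (E i)) (t : Finset ι)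
    (φ : ∀ i, E i) (hφ : ∀ i ∈ t, φ i ∈ closure (Submodule.span R (D i) : Set (E i))) :
    (∑ i ∈ t, T i (φ i)) ∈ (Submodule.span R (⋃ i, T i '' D i)).topologicalClosure := by
  refine Submodule.sum_mem _ fun i hi => ?_
  have h1 : T i (φ i) ∈ closure (Submodule.span R (T i '' D i) : Set X) :=
    image_closure_span_subset i (T i) (D i) ⟨φ i, hφ i hi, rfl⟩
  rw [← Submodule.topologicalClosure_coe] at h1
  exact (Submodule.topologicalClosure_mono
    (Submodule.span_mono (Set.subset_iUnion (fun i => T i '' D i) i))) h1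

/-- **Density inside a subspace from a sum decomposition into transported dense pieces.**  If the `T_i` carry the
`D_i` into `S` and every `s ∈ S` is a finite sum `Σ T_i φ_i` with `φ_i ∈ closure (span D_i)`, then
`{s ∈ S | s ∈ span ⋃_i T_i(D_i)}` is dense in `S`. [folklore] -/
theorem dense_span_image_of_sum_decomposition (S : Submodule R X) (T : ∀ i, E i →L[R] X) (D : ∀ i, Set (E i))
    (hD : ∀ i, T i '' D i ⊆ S)
    (hdec : ∀ s ∈ S, ∃ (t : Finset ι) (φ : ∀ i, E i),
      (∀ i ∈ t, φ i ∈ closure (Submodule.span R (D i) : Set (E i))) ∧ s = ∑ i ∈ t, T i (φ i)) :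
    Dense {s : S | (s : X) ∈ Submodule.span R (⋃ i, T i '' D i)} := by
  set A : Submodule R X := Submodule.span R (⋃ i, T i '' D i) with hA
  have hAS : (A : Set X) ⊆ S := by
    rw [hA]
    exact Submodule.span_le.mpr (Set.iUnion_subset hD)
  rw [dense_iff_closure_eq, Set.eq_univ_iff_forall]
  intro s
  obtain ⟨t, φ, hφ, hs⟩ := hdec s s.2
  have hmem : (s : X) ∈ closure (A : Set X) := by
    rw [← Submodule.topologicalClosure_coe, hs]
    exact mem_topologicalClosure_span_of_sum T D t φ hφ
  have himg : ((↑) : S → X) '' {s : S | (s : X) ∈ A} = (A : Set X) := by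
    ext x
    constructor
    · rintro ⟨s', hs', rfl⟩; exact hs'
    · intro hx; exact ⟨⟨x, hAS hx⟩, hx, rfl⟩
  rw [closure_subtype, himg]
  exact hmem

end Literature.Analysis.OperatorTheory
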